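import Summits.BirchSwinnertonDyer.Rank1Residual.ManinAdditive.KatoShiftTwoCoreLaws
import HarnessLib
import HarnessLib.Audit.Tags

/-!
# Law 6b-res — the odd-Nebentypus residual of the cuspidal Kummer parity law, NAMED (C2 line, `ManinOddAtFour`; T-an-46)

TYPER NOTE (typer g20, T-an-46).  SOURCE = HOME/an/g38/CuspidalKummerEvenResidual-an-g38.lean sha16 dc62e51f4c3addad (101 l.; an: farm rc 0 · 0 err ·
0 warn · 0 s∗rry; BC7 2/2 CLEAN g38-bc7-6bres.out a2f31a15aec5130c; by-name glue ByName83-g38.lean 80f566b41e9de610 rc 0; refuter ref1 §R176: CLEAN AS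
TYPED, 6b-res = the C2 v22 stub type (Iff.rfl) = p2's `hL`; §R176 ADDENDUM: 6b-res is NECESSARY for C2 on the non-blind core locus) VERBATIM except this
note.  Statement-only: `@[conjecture]` (an's own tags) **6b-res `CuspidalKummerEvenExponentSquareOnCore`** (= C2 skeleton v22
`stub_cuspidalKummerEvenExponentSquareOnCore` type = hypothesis `hL` of p2's `SquareRootDescent.cuspidalKummerOddExponentOnCore_of_isSquare_half`,
p724791, verbatim) and **6b-res♮ `CuspidalKummerEvenExponentSquare`** (4 ∣ N, no core hypotheses); PROVED (pure logic) `…OnCore_of_evenExponentSquare`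
(♮ ⟹ 6b-res) and `…OnCore_of_oddExponentOnCore` (6b‴ `KatoShiftTwoCore.CuspidalKummerOddExponentOnCore` ⟹ 6b-res).  The converse 6b-res ⟹ 6b‴ is p2's
theorem by name; the typer lands it as the `iff` in the Theorems-importing companion `CuspidalKummerEvenResidualHolds.lean` when that import cone is
Theses-free (else it stays a p-seat line).  Typer checks: decl names fresh in the tree (no p-seat theorem of these rows); imports the landed
`…ManinAdditive.KatoShiftTwoCoreLaws` only — route-independent; no instances, no notation; own farm check rc 0 · 0 warnings.  PARTITION 2 · beyond-print
theorem: no · bears_on stmt-BirchSwinnertonDyer-22967 (C2 `ManinOddAtFour`, v23 stub 6b-res) · BSD is not proved by this; 6b-res, 6b-res♮, C2 OPEN.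

Cell bsd-f2-manin, seat -an g38 (analytic / period-lattice lens), 2026-08-29; ask of the C2 LEAD (STATUS 2026-08-29T15:08:37Z, LEAD-MEMO v27 §4.3:
"if you TYPE the residual as a named law I re-point v23 by name").  Route ManinLocalTwoThree, crux C2 = `ManinOddAtFour` (stmt-22967), C2 LEAD skeleton
v22 (`Cruxes/ManinOddAtFour/Lines/kato_shift_two.lean`, commit 8e7890dae4c5), STUB 6b-res `stub_cuspidalKummerEvenExponentSquareOnCore`.

p2 g17's square-root descent (`Theorems/ManinLocalTwoThreeSquareRootDescent.lean`, p724791) proves the TRIVIAL-character half of an's parity law E-an-53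
(`CuspidalKummer.CuspidalKummerOddExponent`, and its core reading 6b‴ `CuspidalKummerOddExponentOnCore` of `KatoShiftTwoCoreLaws`): a cuspidal Kummer
representative `Ξ_T·g² = A·∏_δ η(q^δ)^{r_δ}/B` of a NON-blind rational 2-torsion point `T` either has an odd exponent `r_δ` or — all `r_δ` even — the integer
`∏_δ δ^{|r_δ/2|}` is NOT a square (`exists_odd_or_not_isSquare_of_isCuspidalKummerRep`), reducing 6b‴ to its ODD-NEBENTYPUS RESIDUAL
(`cuspidalKummerOddExponentOnCore_of_isSquare_half`, hypothesis `hL`).  This file NAMES that residual, VERBATIM (= the type of the v22 stub = p2's `hL`):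

* `CuspidalKummerEvenExponentSquareOnCore` (6b-res, at `16 ∣ N` on the core: potentially good `j`, additive twists by `−1, ±2`) — OPEN, `c`-free;
* `CuspidalKummerEvenExponentSquare` (6b-res♮, at `4 ∣ N`, no core hypotheses = the `hL` of `cuspidalKummerOddExponent_of_isSquare_half`) — OPEN, `c`-free, STRONGER;
* PROVED (pure logic): `cuspidalKummerEvenExponentSquareOnCore_of_evenExponentSquare` (restriction `4 ∣ N ⟸ 16 ∣ N`) and
  `cuspidalKummerEvenExponentSquareOnCore_of_oddExponentOnCore` (6b‴ ⟹ 6b-res: with all exponents even an odd one is absurd), so that with p2's theorem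
  6b-res ⟺ 6b‴ (the converse `6b-res ⟹ 6b‴` is `SquareRootDescent.cuspidalKummerOddExponentOnCore_of_isSquare_half`, by name — checked in the cell scratch
  HOME/an/g38/ByName83-g38.lean, not imported here to keep the statement layer `Theorems`-free).

MEANING.  With all `r_δ` even the representative reads `Ξ_T = (A/B)·(∏_δ η(q^δ)^{r_δ/2}/g)²·1`, i.e. `Ξ_T` is a square in `ℚ((q))` up to the η-quotient
`∏ η(δτ)^{r_δ/2}`, a modular unit/form on `Γ₀(N)` with the quadratic character `χ = (∏_δ δ^{|r_δ/2|} | ·)` (Newman / Ligozat criteria); the law says that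
for a NON-blind `T` this character is trivial on squares, i.e. `∏ δ^{|r_δ/2|} ∈ ℤ²`: the `Σ(2N)[2]`-case isolated by the LEAD (where E-an-151/152b live).
Why it might fail: a non-blind rational 2-torsion point whose cuspidal Kummer class is an η-square class with a genuinely quadratic Nebentypus (none in the
cell's census: 367/367 classes at `16 ∣ N`, data D-an-17(b) v3; E-an-53 falsifier tables).  Sources: cell CANDIDATES E-an-53/151/152b, p2 p724791, C2 LEAD v22;
[Ligozat1975] G. Ligozat, *Courbes modulaires de genre 1*, Mém. SMF 43, Prop. 3.2.1 (η-quotient modularity criterion); [Newman1959] M. Newman, *Construction and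
application of a class of modular functions II*, PLMS (3) 9, Thm. 1.

PARTITION 2 (typed conjecture nodes; beyond print as statements: yes; BSD is not proved by this; C2 OPEN).  No `sorry`, no new axioms, no `instance`/`notation`;
imports the ManinAdditive statement layer only.
-/

set_option autoImplicit false

noncomputable section

open scoped Classical MatrixGroups ModularForm NumberField
open IsDedekindDomain IsDedekindDomain.HeightOneSpectrum Rat.HeightOneSpectrum
open PowerSeries CongruenceSubgroup WeierstrassCurve Literature.NumberTheory.EllipticCurves
  Literature.NumberTheory.EllipticCurves.ModularForms
  Summit.BirchSwinnertonDyer.Rank1Residual.ManinAdditive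
  Summit.BirchSwinnertonDyer.Rank1Residual.ManinAdditive.CuspidalKummer
  Summit.BirchSwinnertonDyer.Rank1Residual.ManinAdditive.ShimuraLedger

namespace Summit.BirchSwinnertonDyer.Rank1Residual.ManinAdditive.CuspidalKummer

/-- **Law 6b-res `CuspidalKummerEvenExponentSquareOnCore`** (= C2 v22 `stub_cuspidalKummerEvenExponentSquareOnCore` = p2's `hL` of
`SquareRootDescent.cuspidalKummerOddExponentOnCore_of_isSquare_half`, VERBATIM): on the core at `16 ∣ N` (potentially good `j` at `2`, the twists by
`−1, 2, −2` still additive of conductor exponent `≥ 2`), for a NON-blind rational 2-torsion point `(e, 0)` of the `a₁ = a₃ = 0` model, every cuspidal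
Kummer representative of `Ξ_{(e,0)}` with ALL `η`-exponents even has `∏_δ δ^{|r_δ/2|}` a perfect square.  OPEN, `c`-free; the odd-Nebentypus
(`Σ(2N)[2]`) residual of 6b‴.  Why it might fail: an η-square class with quadratic Nebentypus for a non-blind point (census: none, 367/367).
[conjecture: this programme — cell bsd-f2-manin E-an-53 residual, C2 skeleton v22] -/
@[conjecture]
def CuspidalKummerEvenExponentSquareOnCore : Prop :=
  ∀ (W : WeierstrassCurve ℚ) [W.IsElliptic] [W.IsGloballyMinimal] {N : ℕ} [NeZero N]
    (D : ModularParametrizationData W N) (a : ℕ → ℤ), (∀ n, (a n : ℂ) = cuspCoeff D.f n) →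
    2 ^ 4 ∣ N → (∀ z ∈ D.L.lattice, ∃ w ∈ periodLattice D.f, z = D.c * w) →
    ((primesEquiv (R := 𝓞 ℚ)).symm ⟨2, Nat.prime_two⟩).valuation ℚ W.j < 1 →
    (∀ d : ℤ, d = -1 ∨ d = 2 ∨ d = -2 →
      2 ≤ (W.quadraticTwist (d : ℚ)).conductorExponent ((primesEquiv (R := ℤ)).symm ⟨2, Nat.prime_two⟩)) →
    ∀ (a₂ a₄ e : ℤ), W.a₁ = 0 → W.a₃ = 0 → W.a₂ = a₂ → W.a₄ = a₄ →
    W.twoTorsionPolynomial.toPoly.IsRoot (e : ℚ) → ¬ KummerBlindAtTwo a₂ a₄ e →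
    ∀ z : ℚ⟦X⟧, IsParamGerm W D.c a z →
    ∀ (r : ℕ → ℤ) (g A B : ℤ⟦X⟧), IsCuspidalKummerRep N (kummerSeries W D.c ((e : ℚ)) z) r g A B →
    (∀ δ ∈ N.divisors, Even (r δ)) → IsSquare (∏ δ ∈ N.divisors, δ ^ (r δ / 2).natAbs)

/-- **Law 6b-res♮ `CuspidalKummerEvenExponentSquare`** (= p2's `hL` of `SquareRootDescent.cuspidalKummerOddExponent_of_isSquare_half`, VERBATIM): the same at
`4 ∣ N` WITHOUT the core hypotheses — the odd-Nebentypus residual of an's E-an-53 `CuspidalKummerOddExponent` itself.  OPEN, `c`-free, implies 6b-res.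
[conjecture: this programme — cell bsd-f2-manin E-an-53 residual] -/
@[conjecture]
def CuspidalKummerEvenExponentSquare : Prop :=
  ∀ (W : WeierstrassCurve ℚ) [W.IsElliptic] [W.IsGloballyMinimal] {N : ℕ} [NeZero N]
    (D : ModularParametrizationData W N) (a : ℕ → ℤ), (∀ n, (a n : ℂ) = cuspCoeff D.f n) →
    4 ∣ N → (∀ z ∈ D.L.lattice, ∃ w ∈ periodLattice D.f, z = D.c * w) →
    ∀ (a₂ a₄ e : ℤ), W.a₁ = 0 → W.a₃ = 0 → W.a₂ = a₂ → W.a₄ = a₄ →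
    W.twoTorsionPolynomial.toPoly.IsRoot (e : ℚ) → ¬ KummerBlindAtTwo a₂ a₄ e →
    ∀ z : ℚ⟦X⟧, IsParamGerm W D.c a z →
    ∀ (r : ℕ → ℤ) (g A B : ℤ⟦X⟧), IsCuspidalKummerRep N (kummerSeries W D.c ((e : ℚ)) z) r g A B →
    (∀ δ ∈ N.divisors, Even (r δ)) → IsSquare (∏ δ ∈ N.divisors, δ ^ (r δ / 2).natAbs)

/-- 6b-res♮ ⟹ 6b-res (restriction: `16 ∣ N ⟹ 4 ∣ N`, core hypotheses dropped). -/
theorem cuspidalKummerEvenExponentSquareOnCore_of_evenExponentSquare (h : CuspidalKummerEvenExponentSquare) :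
    CuspidalKummerEvenExponentSquareOnCore := by
  intro W _ _ N _ D a ha h16 hLat _hj _hcore a₂ a₄ e ha1 ha3 ha2 ha4 he hnb z hz r g A B hrep hev
  exact h W D a ha ((by norm_num : (4 : ℕ) ∣ 2 ^ 4).trans h16) hLat a₂ a₄ e ha1 ha3 ha2 ha4 he hnb z hz r g A B hrep hev

/-- 6b‴ ⟹ 6b-res (pure logic: an odd exponent contradicts "all exponents even"); with p2's
`SquareRootDescent.cuspidalKummerOddExponentOnCore_of_isSquare_half` (6b-res ⟹ 6b‴) the two laws are EQUIVALENT. -/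
theorem cuspidalKummerEvenExponentSquareOnCore_of_oddExponentOnCore (h : CuspidalKummerOddExponentOnCore) :
    CuspidalKummerEvenExponentSquareOnCore := by
  intro W _ _ N _ D a ha h16 hLat hj hcore a₂ a₄ e ha1 ha3 ha2 ha4 he hnb z hz r g A B hrep hev
  obtain ⟨δ, hδ, hodd⟩ := h W D a ha h16 hLat hj hcore a₂ a₄ e ha1 ha3 ha2 ha4 he hnb z hz r g A B hrep
  exact absurd (hev δ hδ) (Int.not_even_iff_odd.mpr hodd)

end Summit.BirchSwinnertonDyer.Rank1Residual.ManinAdditive.CuspidalKummer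

end
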